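import Mathlib.Analysis.InnerProductSpace.Calculus
import Literature.NumberTheory.Automorphic.ArchKTypeWeightVector
import Literature.NumberTheory.Automorphic.ArchGardingMeasureSmoothing
import Literature.NumberTheory.Automorphic.ArchTranslateExpStable
import HarnessLib

/-!
# Finite-dimensional `τ(X)`-stable subspaces of the Gårding space of `GL_n(K_∞)`: exponential stability,
# skew-symmetry of the infinitesimal action, `K_∞`-finiteness of `τ(X) v`
# (Harish-Chandra (1953); Knapp (1986), Ch. III §3, Ch. VIII §2–3)

Topic `NumberTheory/Automorphic`; namespace `Literature.NumberTheory.Automorphic`. Theorems only (no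
definition, no named fact, no instance). Three standard facts about a strongly continuous representation
`τ` of `G_∞ = GL_n(K_∞)` on a Hilbert space `E` and its Gårding space `𝒢` (`ArchGardingWhittaker`,
`ArchGardingEnd`), used by the archimedean test-vector construction of Jacquet–Langlands (1970), §5–§6:

* `inner_archDerivE_eq_neg` — **for unitary `τ` every `τ(X)`, `X ∈ 𝔤𝔩_n(K_∞)` (a REAL Lie algebra),
  is skew-symmetric on `𝒢`**: `⟪τ(X) v, v'⟫ = -⟪v, τ(X) v'⟫` (differentiate the constant
  `t ↦ ⟪τ(e^{tX}) v, τ(e^{tX}) v'⟫ = ⟪v, v'⟫`); hence the orthogonal complement, inside a finite-dimensional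
  `τ(X)`-stable `V ⊆ 𝒢`, of a `τ(X)`-stable subspace is `τ(X)`-stable (`gardingEnd_mem_orthogonal`).
* `gardingAct_expGL_mem_of_gardingEnd_mem` — **a finite-dimensional `τ(X)`-stable subspace `V ⊆ 𝒢` is
  `τ(exp tX)`-stable** (Harish-Chandra): for `z ⊥ V` the coordinates `u_j(t) = ⟪z, τ(e^{tX}) b_j⟫` of a basis
  solve the constant-coefficient system `u' = M u` with `u(0) = 0`, hence vanish
  (`eq_exp_mulVec_of_hasDerivAt_mulVec`), and `V` is closed.
* `exists_kStable_finiteDimensional_forall_gardingEnd_mem` — **`τ(X)` of a `K_∞`-finite Gårding vector is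
  `K_∞`-finite**: for a finite-dimensional `K_∞`-stable `V ⊆ 𝒢` the span `W` of all `τ(X) y`
  (`X ∈ 𝔤𝔩_n(K_∞)`, `y ∈ V`) is finite-dimensional (`τ(X) y` is `ℝ`-linear in `X`, `ℂ`-linear in `y`)
  and `K_∞`-stable (`τ(κ) τ(X) y = τ(Ad(κ) X) τ(κ) y`), and so is `V + W`.

## References

* Harish-Chandra, *Representations of a semisimple Lie group on a Banach space. I*, Trans. AMS 75 (1953),
  §9–§10 (well-behaved / `K`-finite vectors).
* A. W. Knapp, *Representation Theory of Semisimple Groups*, Princeton 1986, Ch. III §3 (Prop. 3.9),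
  Ch. VIII §2–§3. [Knapp1986]
* A. Borel, *Automorphic forms on SL₂(ℝ)*, CUP 1997, 2.16, 8.6. [Borel1997]
-/

noncomputable section

open MeasureTheory Measure NumberField NumberField.InfinitePlace NumberField.mixedEmbedding IsDedekindDomain Set Filter
open scoped MatrixGroups Topology Classical InnerProductSpace

namespace Literature.NumberTheory.Automorphic

variable {n : ℕ} {K : Type} [Field K] [NumberField K]

-- as in `ArchGardingWhittaker`
set_option backward.isDefEq.respectTransparency false

/-! ### 1. Skew-symmetry of `τ(X)` for unitary `τ` -/

section Skew

variable {hcpt : isCompact_glFiniteIntegralLevel n K}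
  {E : Type*} [NormedAddCommGroup E] [InnerProductSpace ℂ E] [CompleteSpace E]
  {τ : ContRepresentation ℂ (AutomorphyDatum.gl n K hcpt).arch.carrier E}
  (hτ : τ.IsStronglyContinuous)

include hτ in
/-- **`τ(X)` is skew-symmetric on the Gårding space of a unitary representation**, for every
`X ∈ 𝔤𝔩_n(K_∞)`: `⟪τ(X) v, v'⟫ = -⟪v, τ(X) v'⟫` (Knapp (1986), Ch. III §3). [cite: Knapp1986, Ch. III §3] -/
theorem inner_archDerivE_eq_neg (hτu : τ.IsUnitary) (X : Matrix (Fin n) (Fin n) (mixedSpace K))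
    {v v' : E} (hv : v ∈ archGardingSpace hcpt τ) (hv' : v' ∈ archGardingSpace hcpt τ) :
    ⟪archDerivE hcpt τ X v, v'⟫_ℂ = -⟪v, archDerivE hcpt τ X v'⟫_ℂ := by
  have h1 := hasDerivAt_apply_expGL_of_mem_archGardingSpace (hcpt := hcpt) (τ := τ) hτ hv X
  have h2 := hasDerivAt_apply_expGL_of_mem_archGardingSpace (hcpt := hcpt) (τ := τ) hτ hv' X
  have h := h1.inner ℂ h2
  have hconst : (fun t : ℝ => ⟪τ (toArch hcpt (expGL (t • X))) v, τ (toArch hcpt (expGL (t • X))) v'⟫_ℂ) =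
      fun _ => ⟪v, v'⟫_ℂ := by
    funext t
    exact hτu.inner_map_map _ v v'
  rw [hconst] at h
  have h0 := h.unique (hasDerivAt_const (0 : ℝ) _)
  have e0 : τ (toArch hcpt (expGL ((0 : ℝ) • X))) = 1 := by
    rw [zero_smul, expGL_zero]; exact map_one τ
  rw [e0, one_apply_eq_self, one_apply_eq_self] at h0
  exact eq_neg_of_add_eq_zero_right h0

include hτ in
/-- `End(𝒢)`-form: `⟪τ(X) v, v'⟫ = -⟪v, τ(X) v'⟫` for `v, v' ∈ 𝒢`. [cite: Knapp1986, Ch. III §3] -/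
theorem inner_gardingEnd_eq_neg (hτu : τ.IsUnitary) (X : Matrix (Fin n) (Fin n) (mixedSpace K))
    (v v' : archGardingSpace hcpt τ) :
    ⟪((gardingEnd hτ X v : archGardingSpace hcpt τ) : E), (v' : E)⟫_ℂ = -⟪(v : E), ((gardingEnd hτ X v' : archGardingSpace hcpt τ) : E)⟫_ℂ := by
  rw [coe_gardingEnd_apply, coe_gardingEnd_apply]
  exact inner_archDerivE_eq_neg hτ hτu X v.2 v'.2

include hτ in
/-- **Orthogonal complements of `τ(X)`-stable subspaces are `τ(X)`-stable** (inside a `τ(X)`-stable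
finite-dimensional `V ⊆ 𝒢`, for unitary `τ`): if `U ⊆ V` is `τ(X)`-stable then so is
`{v ∈ V : v ⊥ U}`. [cite: Knapp1986, Ch. III §3] -/
theorem gardingEnd_mem_orthogonal (hτu : τ.IsUnitary) {V U : Submodule ℂ (archGardingSpace hcpt τ)}
    {X : Matrix (Fin n) (Fin n) (mixedSpace K)} (hV : ∀ v ∈ V, gardingEnd hτ X v ∈ V) (hU : ∀ u ∈ U, gardingEnd hτ X u ∈ U)
    {v : archGardingSpace hcpt τ} (hvV : v ∈ V) (hv : ∀ u ∈ U, ⟪(u : E), (v : E)⟫_ℂ = 0) :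
    gardingEnd hτ X v ∈ V ∧ ∀ u ∈ U, ⟪(u : E), ((gardingEnd hτ X v : archGardingSpace hcpt τ) : E)⟫_ℂ = 0 := by
  refine ⟨hV v hvV, fun u hu => ?_⟩
  have h := inner_gardingEnd_eq_neg hτ hτu X u v
  rw [hv _ (hU u hu)] at h
  rw [← neg_neg ⟪(u : E), _⟫_ℂ, ← h, neg_zero]

end Skew

/-! ### 2. Exponential stability of finite-dimensional `τ(X)`-stable subspaces -/

section Exp

variable {hcpt : isCompact_glFiniteIntegralLevel n K}
  {E : Type*} [NormedAddCommGroup E] [InnerProductSpace ℂ E] [CompleteSpace E]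
  {τ : ContRepresentation ℂ (AutomorphyDatum.gl n K hcpt).arch.carrier E}
  (hτ : τ.IsStronglyContinuous)

include hτ in
/-- **Harish-Chandra: a finite-dimensional `τ(X)`-stable subspace of the Gårding space is
`τ(exp tX)`-stable.** (Knapp (1986), Ch. VIII §2; Borel (1997), 8.6.) [cite: Knapp1986, Ch. VIII §2] -/
theorem gardingAct_expGL_mem_of_gardingEnd_mem {V : Submodule ℂ (archGardingSpace hcpt τ)} [FiniteDimensional ℂ V]
    {X : Matrix (Fin n) (Fin n) (mixedSpace K)} (hX : ∀ v ∈ V, gardingEnd hτ X v ∈ V) (t : ℝ)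
    {v : archGardingSpace hcpt τ} (hv : v ∈ V) : gardingAct hτ (expGL (t • X)) v ∈ V := by
  -- a basis of `V` and the matrix of `τ(X)` on it
  set d := Module.finrank ℂ V with hd
  let b : Module.Basis (Fin d) ℂ V := Module.finBasis ℂ V
  let TX : V →ₗ[ℂ] V := (gardingEnd hτ X).restrict hX
  let M : Matrix (Fin d) (Fin d) ℂ := fun i j => b.repr (TX (b i)) j
  have hTX : ∀ i, (((TX (b i) : V) : archGardingSpace hcpt τ) : E) = ∑ j, M i j • (((b j : V) : archGardingSpace hcpt τ) : E) := by
    intro i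
    have h := (b.sum_repr (TX (b i))).symm
    have h' := congrArg (fun y : V => ((y : archGardingSpace hcpt τ) : E)) h
    simp only [Submodule.coe_sum, Submodule.coe_smul] at h'
    exact h'
  -- the closed image of `V` in `E`
  set S : Submodule ℂ E := (V.map (archGardingSpace hcpt τ).subtype) with hS
  haveI : FiniteDimensional ℂ S := inferInstance
  have hSc : IsClosed (S : Set E) := Submodule.closed_of_finiteDimensional S
  haveI : CompleteSpace S := hSc.completeSpace_coe
  have hbS : ∀ j, (((b j : V) : archGardingSpace hcpt τ) : E) ∈ S := fun j => ⟨_, (b j).2, rfl⟩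
  -- for `z ⊥ S` the coordinates `u_j(t) = ⟪z, τ(e^{tX}) b_j⟫` vanish identically
  have horth : ∀ z ∈ Sᗮ, ∀ (s : ℝ) (j : Fin d),
      ⟪z, τ (toArch hcpt (expGL (s • X))) (((b j : V) : archGardingSpace hcpt τ) : E)⟫_ℂ = 0 := by
    intro z hz
    set u : ℝ → Fin d → ℂ := fun s j => ⟪z, τ (toArch hcpt (expGL (s • X))) (((b j : V) : archGardingSpace hcpt τ) : E)⟫_ℂ
      with hu
    have hderiv : ∀ s, HasDerivAt u (M.mulVec (u s)) s := by
      intro s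
      rw [hasDerivAt_pi]
      intro j
      have h1 := hasDerivAt_apply_expGL_smul (hcpt := hcpt) (τ := τ) hτ ((b j : V) : archGardingSpace hcpt τ).2 X s
      have h2 := ((innerSL ℂ z).restrictScalars ℝ).hasFDerivAt.comp_hasDerivAt s h1
      have e1 : archDerivE hcpt τ X (((b j : V) : archGardingSpace hcpt τ) : E) = (((TX (b j) : V) : archGardingSpace hcpt τ) : E) := rfl
      have e2 : ((innerSL ℂ z).restrictScalars ℝ) (τ (toArch hcpt (expGL (s • X))) (archDerivE hcpt τ X (((b j : V) : archGardingSpace hcpt τ) : E))) =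
          M.mulVec (u s) j := by
        rw [ContinuousLinearMap.coe_restrictScalars', innerSL_apply_apply, e1, hTX j, _root_.map_sum, inner_sum]
        simp only [Matrix.mulVec, dotProduct, map_smul, inner_smul_right]
        rfl
      rw [← e2]
      exact h2
    have hu0 : u 0 = 0 := by
      funext j
      simp only [hu, zero_smul, expGL_zero, Pi.zero_apply]
      have e1 : τ (toArch hcpt (1 : GL (Fin n) (mixedSpace K))) = 1 := map_one τ
      rw [e1, one_apply_eq_self]
      exact Submodule.inner_left_of_mem_orthogonal (hbS j) hz
    intro s j
    have h := eq_exp_mulVec_of_hasDerivAt_mulVec M hderiv s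
    rw [hu0, Matrix.mulVec_zero] at h
    exact congrFun h j
  -- hence `τ(e^{tX}) b_j ∈ Sᗮᗮ = S`
  have hmemS : ∀ j, τ (toArch hcpt (expGL (t • X))) (((b j : V) : archGardingSpace hcpt τ) : E) ∈ S := by
    intro j
    rw [← Submodule.orthogonal_orthogonal S]
    exact (Submodule.mem_orthogonal Sᗮ _).2 fun z hz => horth z hz t j
  have hmemV : ∀ j, gardingAct hτ (expGL (t • X)) ((b j : V) : archGardingSpace hcpt τ) ∈ V := by
    intro j
    obtain ⟨y, hy, hy'⟩ := hmemS j
    have : gardingAct hτ (expGL (t • X)) ((b j : V) : archGardingSpace hcpt τ) = y := Subtype.ext (by rw [coe_gardingAct_apply]; exact hy'.symm)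
    rw [this]; exact hy
  -- and by linearity all of `V`
  have hvs := (b.sum_repr ⟨v, hv⟩).symm
  have hv' : v = ∑ j, b.repr ⟨v, hv⟩ j • ((b j : V) : archGardingSpace hcpt τ) := by
    have h := congrArg (fun y : V => (y : archGardingSpace hcpt τ)) hvs
    simp only [Submodule.coe_sum, Submodule.coe_smul] at h
    exact h
  rw [hv', _root_.map_sum]
  exact Submodule.sum_mem _ fun j _ => by rw [map_smul]; exact Submodule.smul_mem _ _ (hmemV j)

end Exp

/-! ### 3. `τ(X)` of a `K_∞`-finite Gårding vector is `K_∞`-finite -/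

section KFinite

variable {hcpt : isCompact_glFiniteIntegralLevel n K}
  {E : Type*} [NormedAddCommGroup E] [NormedSpace ℂ E] [CompleteSpace E]
  {τ : ContRepresentation ℂ (AutomorphyDatum.gl n K hcpt).arch.carrier E}
  (hτ : τ.IsStronglyContinuous)

include hτ in
/-- **`τ(𝔤) V` is finite-dimensional and `K_∞`-stable for a finite-dimensional `K_∞`-stable `V ⊆ 𝒢`**,
hence `τ(X) v` is `K_∞`-finite for `K_∞`-finite `v` (Harish-Chandra (1953); Knapp (1986), Ch. VIII §3,
proof of Prop. 8.5: `τ(k) τ(X) v = τ(Ad(k) X) τ(k) v`). [cite: Knapp1986, Ch. VIII §3] -/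
theorem exists_kStable_finiteDimensional_forall_gardingEnd_mem (V : Submodule ℂ (archGardingSpace hcpt τ))
    [FiniteDimensional ℂ V] (hK : ∀ κ ∈ Kinf n K, ∀ v ∈ V, gardingAct hτ κ v ∈ V) :
    ∃ W : Submodule ℂ (archGardingSpace hcpt τ), FiniteDimensional ℂ W ∧
      (∀ κ ∈ Kinf n K, ∀ v ∈ W, gardingAct hτ κ v ∈ W) ∧ V ≤ W ∧
      ∀ (X : Matrix (Fin n) (Fin n) (mixedSpace K)), ∀ v ∈ V, gardingEnd hτ X v ∈ W := by
  -- bases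
  let bM := Module.finBasis ℝ (Matrix (Fin n) (Fin n) (mixedSpace K))
  let bV := Module.finBasis ℂ V
  set W₀ : Submodule ℂ (archGardingSpace hcpt τ) := Submodule.span ℂ (Set.range fun p :
    Fin (Module.finrank ℝ (Matrix (Fin n) (Fin n) (mixedSpace K))) × Fin (Module.finrank ℂ V) =>
      gardingEnd hτ (bM p.1) ((bV p.2 : V) : archGardingSpace hcpt τ)) with hW₀
  haveI hW₀fd : FiniteDimensional ℂ W₀ := FiniteDimensional.span_of_finite ℂ (Set.finite_range _)
  -- every `τ(X) y`, `y ∈ V`, lies in `W₀`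
  have hmem : ∀ (X : Matrix (Fin n) (Fin n) (mixedSpace K)), ∀ y ∈ V, gardingEnd hτ X y ∈ W₀ := by
    intro X y hy
    have hX : X = ∑ i, bM.repr X i • bM i := (bM.sum_repr X).symm
    have hy' : y = ∑ j, bV.repr ⟨y, hy⟩ j • ((bV j : V) : archGardingSpace hcpt τ) := by
      have h := congrArg (fun z : V => (z : archGardingSpace hcpt τ)) (bV.sum_repr ⟨y, hy⟩).symm
      simp only [Submodule.coe_sum, Submodule.coe_smul] at h
      exact h
    rw [hX, gardingEnd_sum_smul, LinearMap.sum_apply]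
    refine Submodule.sum_mem _ fun i _ => ?_
    rw [LinearMap.smul_apply]
    refine Submodule.smul_mem _ _ ?_
    rw [hy', _root_.map_sum]
    refine Submodule.sum_mem _ fun j _ => ?_
    rw [map_smul]
    exact Submodule.smul_mem _ _ (Submodule.subset_span ⟨(i, j), rfl⟩)
  -- `W₀` is `K_∞`-stable
  have hKW₀ : ∀ κ ∈ Kinf n K, ∀ v ∈ W₀, gardingAct hτ κ v ∈ W₀ := by
    intro κ hκ v hv
    refine Submodule.span_induction (p := fun v _ => gardingAct hτ κ v ∈ W₀) ?_ ?_ ?_ ?_ hv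
    · rintro _ ⟨p, rfl⟩
      rw [← Module.End.mul_apply, gardingAct_mul_gardingEnd hτ, Module.End.mul_apply]
      exact hmem _ _ (hK κ hκ _ (bV p.2).2)
    · rw [map_zero]; exact Submodule.zero_mem _
    · intro x y _ _ hx hy
      rw [map_add]; exact Submodule.add_mem _ hx hy
    · intro c x _ hx
      rw [map_smul]; exact Submodule.smul_mem _ c hx
  refine ⟨V ⊔ W₀, inferInstance, fun κ hκ v hv => ?_, le_sup_left, fun X v hv => Submodule.mem_sup_right (hmem X v hv)⟩
  obtain ⟨y, hy, z, hz, rfl⟩ := Submodule.mem_sup.1 hv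
  rw [map_add]
  exact Submodule.add_mem _ (Submodule.mem_sup_left (hK κ hκ y hy)) (Submodule.mem_sup_right (hKW₀ κ hκ z hz))

include hτ in
/-- Iterated form: the monomials `τ(X₁) ⋯ τ(X_k)` of `U(𝔤)` send a finite-dimensional `K_∞`-stable
`V ⊆ 𝒢` into a finite-dimensional `K_∞`-stable `W ⊇ V` (depending on `k`). [cite: Knapp1986, Ch. VIII §3] -/
theorem exists_kStable_finiteDimensional_forall_prod_map_gardingEnd_mem (V : Submodule ℂ (archGardingSpace hcpt τ))
    [FiniteDimensional ℂ V] (hK : ∀ κ ∈ Kinf n K, ∀ v ∈ V, gardingAct hτ κ v ∈ V) (k : ℕ) :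
    ∃ W : Submodule ℂ (archGardingSpace hcpt τ), FiniteDimensional ℂ W ∧
      (∀ κ ∈ Kinf n K, ∀ v ∈ W, gardingAct hτ κ v ∈ W) ∧ V ≤ W ∧
      ∀ ws : List (Matrix (Fin n) (Fin n) (mixedSpace K)), ws.length ≤ k → ∀ v ∈ V, (ws.map (gardingEnd hτ)).prod v ∈ W := by
  induction k with
  | zero =>
    refine ⟨V, inferInstance, hK, le_rfl, fun ws hws v hv => ?_⟩
    rw [List.length_eq_zero_iff.1 (Nat.le_zero.1 hws)]
    simpa using hv
  | succ k ih =>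
    obtain ⟨W, hWfd, hKW, hVW, hW⟩ := ih
    haveI := hWfd
    obtain ⟨W', hW'fd, hKW', hWW', hW'⟩ := exists_kStable_finiteDimensional_forall_gardingEnd_mem hτ W hKW
    refine ⟨W', hW'fd, hKW', hVW.trans hWW', fun ws hws v hv => ?_⟩
    cases ws with
    | nil => simpa using hWW' (hVW hv)
    | cons X ws =>
      rw [List.map_cons, List.prod_cons, Module.End.mul_apply]
      refine hW' X _ (hW ws ?_ v hv)
      simpa using hws

end KFinite

end Literature.NumberTheory.Automorphic
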